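import Summits.Ventures.QEC.Census.CSSNormalFormSAT.Encode
import Mathlib.Data.Finset.Card
import Mathlib.Data.List.Dedup
import HarnessLib

/-!
# Semantics of the gadgets of `NFEnc` (KERNEL-PLAN item 2, core lemmas): Boolean assignments vs `Sat.Valuation`

LADDER-QEC census cell `(16,1)`, kernel route (census/type-02/css161/KERNEL-PLAN.md). The replay files give
`Sat.Fmla.proof (NFEnc.fmla c) Sat.Clause.nil`: no `Sat.Valuation` satisfies every clause. To USE them one exhibits, from a matrix `P`
satisfying the normal-form conditions, a valuation satisfying every clause. This file provides the generic half: a Boolean assignment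
`β : ℕ → Bool` of the DIMACS variables (variable `x ≥ 1` ↦ `β x`) induces the valuation `valOf β` (`Sat.Literal.ofInt x = pos (x−1)`), and
* `satisfies_of_mem_true` — a clause (list of nonzero DIMACS literals) containing a literal TRUE under `β` is satisfied;
* `satisfies_forbid` — `forbid vs bits` is satisfied as soon as `β` differs from `bits` somewhere on `vs`;
* `satisfies_xorClauses` — if `β z = const ⊕ parity (β on lits)` then every clause of `xorClauses lits z const` is satisfied;
* `satisfies_atLeast` — if at least `t` of the variables `zs` are true then every clause of `atLeast zs t` is satisfied.
(The lex gadget and the assembly over `zClauses/xClauses/symClauses` are the sibling file `EncodeSound.lean`, to come.) [folklore]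
-/

set_option autoImplicit false

namespace Summit.Ventures.QEC.Census.CSSNormalFormSAT

open NFEnc

/-- The valuation induced by a Boolean assignment of the DIMACS variables (`x ≥ 1` ↦ `β x`; `Literal.ofInt x = pos (x − 1)`). (definition) -/
def valOf (β : ℕ → Bool) : Sat.Valuation := fun n => β (n + 1) = true

/-- The Boolean value of a DIMACS literal under `β`: `x > 0 ↦ β x`, `−x ↦ ¬ β x`. (definition) -/
def litVal (β : ℕ → Bool) (l : ℤ) : Bool := if l < 0 then !(β (-l).toNat) else β l.toNat

/-- A positive literal `x ≥ 1` is NOT falsified under `valOf β` iff `β x = true`. [folklore] -/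
theorem neg_ofInt_pos (β : ℕ → Bool) {x : ℕ} (hx : 1 ≤ x) :
    (valOf β).neg (Sat.Literal.ofInt (x : ℤ)) ↔ β x = false := by
  have h1 : ¬ ((x : ℤ) < 0) := by omega
  have h2 : ((x : ℤ) - 1).toNat = x - 1 := by omega
  simp only [Sat.Literal.ofInt, h1, if_false, Sat.Valuation.neg, valOf, h2, Nat.sub_add_cancel hx]
  cases β x <;> simp

/-- A negative literal `−x`, `x ≥ 1`, is NOT falsified under `valOf β` iff `β x = true`… i.e. it IS falsified iff `β x = true`. [folklore] -/
theorem neg_ofInt_neg (β : ℕ → Bool) {x : ℕ} (hx : 1 ≤ x) :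
    (valOf β).neg (Sat.Literal.ofInt (-(x : ℤ))) ↔ β x = true := by
  have h1 : (-(x : ℤ)) < 0 := by omega
  have h2 : (-(-(x : ℤ)) - 1).toNat = x - 1 := by omega
  simp only [Sat.Literal.ofInt, h1, if_true, Sat.Valuation.neg, valOf, h2, Nat.sub_add_cancel hx]

/-- **A clause with a true literal is satisfied.** Literals are `(x : ℤ)` or `-(x : ℤ)` with `x ≥ 1`; if some literal of `cl` has
`litVal β l = true` then `valOf β` satisfies `cl.map ofInt`. [folklore] -/
theorem satisfies_of_mem_true (β : ℕ → Bool) :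
    ∀ cl : List ℤ, (∀ l ∈ cl, l ≠ 0) → (∃ l ∈ cl, litVal β l = true) → (valOf β).satisfies (cl.map Sat.Literal.ofInt)
  | [], _, ⟨l, hl, _⟩ => by simp at hl
  | l :: cs, hnz, hex => by
    rw [List.map_cons]
    intro hneg
    -- the head literal is falsified; the true literal must be in the tail (or the head, contradiction)
    obtain ⟨l', hl', htrue⟩ := hex
    rcases List.mem_cons.1 hl' with rfl | htail
    · exfalso
      have hl0 : l' ≠ 0 := hnz l' List.mem_cons_self
      by_cases hlt : l' < 0
      · -- negative literal -x
        obtain ⟨x, hx1, rfl⟩ : ∃ x : ℕ, 1 ≤ x ∧ l' = -(x : ℤ) := ⟨(-l').toNat, by omega, by omega⟩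
        have hβ := (neg_ofInt_neg β hx1).1 hneg
        simp only [litVal] at htrue
        have : (-(-(x:ℤ))).toNat = x := by omega
        rw [if_pos hlt, this, hβ] at htrue
        simp at htrue
      · obtain ⟨x, hx1, rfl⟩ : ∃ x : ℕ, 1 ≤ x ∧ l' = (x : ℤ) := ⟨l'.toNat, by omega, by omega⟩
        have hβ := (neg_ofInt_pos β hx1).1 hneg
        simp only [litVal] at htrue
        rw [if_neg hlt] at htrue
        have : ((x : ℤ)).toNat = x := by omega
        rw [this, hβ] at htrue
        exact Bool.false_ne_true htrue
    · exact satisfies_of_mem_true β cs (fun l'' h => hnz l'' (List.mem_cons_of_mem _ h)) ⟨l', htail, htrue⟩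

/-! ## `forbid` and `xorClauses` -/

/-- Every element of `bitstrings k` has length `k`. [folklore] -/
theorem length_of_mem_bitstrings : ∀ (k : ℕ) (bits : List Bool), bits ∈ bitstrings k → bits.length = k
  | 0, bits, h => by simp [bitstrings] at h; simp [h]
  | k + 1, bits, h => by
    simp only [bitstrings, List.mem_append, List.mem_map] at h
    rcases h with ⟨b, hb, rfl⟩ | ⟨b, hb, rfl⟩ <;> simp [length_of_mem_bitstrings k b hb]


/-- If `β` differs from `bits` at some position of `vs` (all `≥ 1`), the clause `forbid vs bits` has a true literal. [folklore] -/
theorem exists_true_of_forbid (β : ℕ → Bool) :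
    ∀ (vs : List ℤ) (bits : List Bool), vs.length = bits.length → (∀ v ∈ vs, 1 ≤ v) →
      (List.zipWith (fun v bt => (β v.toNat != bt)) vs bits).any id = true →
      ∃ l ∈ forbid vs bits, litVal β l = true
  | [], [], _, _, h => by simp at h
  | [], _ :: _, h, _, _ => by simp at h
  | _ :: _, [], h, _, _ => by simp at h
  | v :: vs, bt :: bits, hlen, hpos, h => by
    have hv : 1 ≤ v := hpos v List.mem_cons_self
    simp only [List.zipWith_cons_cons, List.any_cons, id, Bool.or_eq_true] at h
    rcases h with h | h
    · refine ⟨if bt then -v else v, by simp [forbid], ?_⟩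
      have hvn : ¬ v < 0 := by omega
      cases bt
      · simp only [Bool.false_eq_true, ↓reduceIte, litVal, hvn]
        simpa using h
      · simp only [↓reduceIte, litVal]
        have : -v < 0 := by omega
        rw [if_pos this, Int.neg_neg]
        simpa using h
    · obtain ⟨l, hl, hlt⟩ := exists_true_of_forbid β vs bits (by simpa using hlen)
        (fun w hw => hpos w (List.mem_cons_of_mem _ hw)) h
      exact ⟨l, by simp [forbid, hl], hlt⟩

/-- Literals of `forbid vs bits` are nonzero when the variables are `≥ 1`. [folklore] -/
theorem forbid_ne_zero : ∀ (vs : List ℤ) (bits : List Bool), (∀ v ∈ vs, 1 ≤ v) → ∀ l ∈ forbid vs bits, l ≠ 0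
  | [], bits, _, l, hl => by cases bits <;> simp [forbid] at hl
  | _ :: _, [], _, l, hl => by simp [forbid] at hl
  | v :: vs, bt :: bits, hpos, l, hl => by
    simp only [forbid, List.mem_cons] at hl
    rcases hl with rfl | hl
    · have := hpos v List.mem_cons_self
      cases bt <;> simp <;> omega
    · exact forbid_ne_zero vs bits (fun w hw => hpos w (List.mem_cons_of_mem _ hw)) l hl

/-- Two Boolean lists of equal length with different parity differ somewhere. [folklore] -/
theorem zipWith_bne_any_of_parity_ne :
    ∀ (xs ys : List Bool), xs.length = ys.length → parity xs ≠ parity ys →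
      (List.zipWith (fun x y => (x != y)) xs ys).any id = true
  | [], [], _, h => by simp [parity] at h
  | [], _ :: _, h, _ => by simp at h
  | _ :: _, [], h, _ => by simp at h
  | x :: xs, y :: ys, hlen, hpar => by
    simp only [List.zipWith_cons_cons, List.any_cons, id, Bool.or_eq_true]
    by_cases hxy : x = y
    · subst hxy
      right
      refine zipWith_bne_any_of_parity_ne xs ys (by simpa using hlen) ?_
      intro h; apply hpar; simp [parity, h]
    · left; cases x <;> cases y <;> simp_all

/-- **XOR gadget soundness**: if the variables `lits` and `z` are `≥ 1` and `β z = const ⊕ parity (β on lits)`, then `valOf β`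
satisfies every clause of `xorClauses lits z const`. [folklore] -/
theorem satisfies_xorClauses (β : ℕ → Bool) (lits : List ℤ) (z : ℤ) (const : Bool)
    (hpos : ∀ v ∈ lits, 1 ≤ v) (hz : 1 ≤ z)
    (hval : parity ((lits ++ [z]).map fun v => β v.toNat) = const) :
    ∀ cl ∈ xorClauses lits z const, (valOf β).satisfies (cl.map Sat.Literal.ofInt) := by
  intro cl hcl
  simp only [xorClauses, List.mem_filterMap] at hcl
  obtain ⟨bits, hbits, hsome⟩ := hcl
  by_cases hne : (parity bits != const) = true
  · rw [if_pos hne] at hsome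
    simp only [Option.some.injEq] at hsome
    subst hsome
    have hposall : ∀ v ∈ lits ++ [z], 1 ≤ v := by
      intro v hv; rcases List.mem_append.1 hv with hv | hv
      · exact hpos v hv
      · simp at hv; omega
    refine satisfies_of_mem_true β _ (forbid_ne_zero _ _ hposall) ?_
    have hlen : (lits ++ [z]).length = bits.length := by
      rw [length_of_mem_bitstrings _ _ hbits]
    refine exists_true_of_forbid β _ _ hlen hposall ?_
    have hpar : parity ((lits ++ [z]).map fun v => β v.toNat) ≠ parity bits := by
      rw [hval]; intro h; rw [← h] at hne; simp at hne
    have h2 := zipWith_bne_any_of_parity_ne ((lits ++ [z]).map fun v => β v.toNat) bits (by simpa using hlen) hpar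
    rw [List.zipWith_map_left] at h2
    exact h2
  · rw [if_neg hne] at hsome
    simp at hsome

/-! ## `combos` and `atLeast` -/

/-- `l.getD j d ∈ l` for `j < l.length`. [folklore] -/
theorem getD_mem_of_lt {α : Type*} : ∀ (l : List α) (d : α) {j : ℕ}, j < l.length → l.getD j d ∈ l
  | [], _, _, h => by simp at h
  | a :: l, d, 0, _ => by simp
  | a :: l, d, j + 1, h => by
    simp only [List.getD_cons_succ, List.mem_cons]
    exact Or.inr (getD_mem_of_lt l d (by simpa using h))


/-- Elements of `combosFrom fuel lo n k`: strictly increasing lists of length `k` with entries in `[lo, n)`. [folklore] -/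
theorem combosFrom_spec : ∀ (fuel lo n k : ℕ) (Z0 : List ℕ), Z0 ∈ combosFrom fuel lo n k →
    Z0.length = k ∧ Z0.Pairwise (· < ·) ∧ ∀ j ∈ Z0, lo ≤ j ∧ j < n
  | fuel, lo, n, 0, Z0, h => by
    cases fuel <;> simp [combosFrom] at h <;> subst h <;> simp
  | 0, lo, n, k + 1, Z0, h => by simp [combosFrom] at h
  | fuel + 1, lo, n, k + 1, Z0, h => by
    simp only [combosFrom] at h
    split_ifs at h with hlt
    · simp at h
    · rcases List.mem_append.1 h with h | h
      · obtain ⟨Z1, hZ1, rfl⟩ := List.mem_map.1 h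
        obtain ⟨hl, hp, hr⟩ := combosFrom_spec fuel (lo + 1) n k Z1 hZ1
        refine ⟨by simp [hl], ?_, ?_⟩
        · rw [List.pairwise_cons]
          exact ⟨fun j hj => by have := (hr j hj).1; omega, hp⟩
        · intro j hj
          rcases List.mem_cons.1 hj with rfl | hj
          · constructor <;> omega
          · have := hr j hj; constructor <;> omega
      · obtain ⟨hl, hp, hr⟩ := combosFrom_spec fuel (lo + 1) n (k + 1) Z0 h
        exact ⟨hl, hp, fun j hj => by have := hr j hj; constructor <;> omega⟩

/-- Elements of `combos n k`: `k` distinct indices `< n`. [folklore] -/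
theorem combos_spec (n k : ℕ) (Z0 : List ℕ) (h : Z0 ∈ combos n k) :
    Z0.length = k ∧ Z0.Nodup ∧ ∀ j ∈ Z0, j < n := by
  obtain ⟨hl, hp, hr⟩ := combosFrom_spec n 0 n k Z0 h
  exact ⟨hl, hp.imp (fun h => Nat.ne_of_lt h), fun j hj => (hr j hj).2⟩

/-- **«at least `t` true» gadget soundness**: if the variables `zs` are `≥ 1` and at least `t` positions of `zs` carry a true variable,
then `valOf β` satisfies every clause of `atLeast zs t`. [folklore] -/
theorem satisfies_atLeast (β : ℕ → Bool) (zs : List ℤ) (t : ℕ) (hpos : ∀ z ∈ zs, 1 ≤ z)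
    (hcount : t ≤ ((Finset.range zs.length).filter fun j => β (zs.getD j 0).toNat = true).card) :
    ∀ cl ∈ atLeast zs t, (valOf β).satisfies (cl.map Sat.Literal.ofInt) := by
  intro cl hcl
  unfold atLeast at hcl
  split_ifs at hcl with ht hlt
  · simp at hcl
  · -- t > len: impossible given hcount
    exfalso
    have := (Finset.card_filter_le (Finset.range zs.length) (fun j => β (zs.getD j 0).toNat = true)).trans_eq
      (Finset.card_range zs.length)
    omega
  · obtain ⟨Z0, hZ0, rfl⟩ := List.mem_map.1 hcl
    obtain ⟨hlen, hnd, hlt'⟩ := combos_spec _ _ Z0 hZ0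
    -- pigeonhole: Z0 (len − t + 1 distinct positions) meets the ≥ t true positions
    set S := (Finset.range zs.length).filter fun j => β (zs.getD j 0).toNat = true with hS
    have hZsub : Z0.toFinset ⊆ Finset.range zs.length := by
      intro j hj; rw [List.mem_toFinset] at hj; exact Finset.mem_range.2 (hlt' j hj)
    have hZcard : Z0.toFinset.card = zs.length - t + 1 := by rw [List.toFinset_card_of_nodup hnd, hlen]
    have hmeet : ∃ j ∈ Z0, β (zs.getD j 0).toNat = true := by
      by_contra hno
      have hno' : ∀ j ∈ Z0, ¬ β (zs.getD j 0).toNat = true := fun j hj h => hno ⟨j, hj, h⟩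
      have hdisj : Disjoint Z0.toFinset S := by
        rw [Finset.disjoint_left]
        intro j hj hjS
        rw [List.mem_toFinset] at hj
        rw [hS, Finset.mem_filter] at hjS
        exact hno' j hj hjS.2
      have h1 : (Z0.toFinset ∪ S).card ≤ zs.length := by
        calc (Z0.toFinset ∪ S).card ≤ (Finset.range zs.length).card :=
              Finset.card_le_card (Finset.union_subset hZsub (Finset.filter_subset _ _))
          _ = zs.length := Finset.card_range _
      rw [Finset.card_union_of_disjoint hdisj, hZcard] at h1
      omega
    obtain ⟨j, hj, hβ⟩ := hmeet
    refine satisfies_of_mem_true β _ ?_ ⟨zs.getD j 0, List.mem_map.2 ⟨j, hj, rfl⟩, ?_⟩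
    · intro l hl
      obtain ⟨j', hj', rfl⟩ := List.mem_map.1 hl
      have hjlt := hlt' j' hj'
      have := hpos _ (getD_mem_of_lt zs 0 hjlt); omega
    · have hjlt := hlt' j hj
      have hmem : zs.getD j 0 ∈ zs := getD_mem_of_lt zs 0 hjlt
      have h1 : ¬ zs.getD j 0 < 0 := by have := hpos _ hmem; omega
      simp only [litVal, h1, if_false]
      exact hβ

end Summit.Ventures.QEC.Census.CSSNormalFormSAT
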